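import Literature.AlgebraicGeometry.Motives.HodgeLieWeightOnePlusLineBasis
import Literature.AlgebraicGeometry.Motives.SpanCInvariantForms
import Literature.Algebra.Lie.InvariantFormSimpleRadical
import HarnessLib

/-!
# Weight one, type-III position, `Lie Hg` `ℚ`-simple: `dim V · tr(z X Y) = tr z · tr(X Y)` for Hodge endomorphisms `z`

Family `hodge`, layer `Literature/AlgebraicGeometry/Motives`; THEOREMS ONLY (no definition, no named fact; D-0026).
Companion of `HodgeLieWeightOnePlusLineKilling` (same method, a second family of rational invariant forms) for the cell
`pub-hodgecm2` (COR-CM) lane MT-RANK-SEVEN-TYPEIII, seat `b27`.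

SETTING (the type-III position): `H` polarizable of weight `1`, `P` the Hodge projector, `E F = αP`, `F E = α(1 − P)`,
`𝔤 = 𝔥_ℂ = ℂE ⊕ ℂF ⊕ ℂΘ ⊕ 𝔨`, `𝔷 = 0`, `Lie Hg` SIMPLE over `ℚ`.  For a RATIONAL Hodge endomorphism `a ∈ End_Hdg(V)` the
TWISTED TRACE FORM `τ_a(X, Y) = tr_V(a X Y)` is a `ℚ`-bilinear invariant form on `Lie Hg` (`a` commutes with `Lie Hg`), so
`β_a = dim V · τ_a − tr(a) · τ` vanishes as soon as its complexification has `E` in its radical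
(`InvariantFormSimpleRadical` + `SpanCInvariantForms`); and it does: `tr(a F E) = α tr a / 2` against `tr(F E) = α dim V / 2`,
everything else in the column of `E` being `0` (trace table of `HodgeLieWeightOnePlusLineBlocks`).

* **`finrank_mul_trace_mul_mul_eq_of_mem_endAlg`** — for rational `a ∈ End_Hdg` and `x, y ∈ 𝔥_ℂ`:
  `dim_ℚ V · tr(a_ℂ x y) = tr(a) · tr(x y)`.
* **`finrank_mul_trace_mul_mul_eq_of_mem_spanC_endAlg`** — the same for every `z ∈ End_Hdg ⊗ ℂ = span_ℂ {a_ℂ}` (the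
  commutant of `𝔥_ℂ`, `mem_span_endAlg_of_forall_commute`): `dim V · tr(z x y) = tr z · tr(x y)`.  Summed over an
  `sl₂`-triple of `𝔨` this pins the Casimir of `𝔨` (sequel `HodgeLieWeightOnePlusLineCasimir`).

## References

* [MoonenZarhin1999LowDim] B. Moonen, Yu. Zarhin, *Hodge classes on abelian varieties of low dimension*, Math. Ann. 315
  (1999), §2 (2.3) Type III.
* [Jacobson1962LieAlgebras] N. Jacobson, *Lie Algebras* (1962), Ch. X §1, Ch. III §4.
* [Deligne1982HodgeCycles] P. Deligne, *Hodge cycles on abelian varieties*, LNM 900 (1982), I §3 (3.4–3.6).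
-/

noncomputable section

open scoped TensorProduct

namespace Literature.AlgebraicGeometry.Motives

universe u

namespace HodgeStructure

open ProjectorBlocks Literature.RepresentationTheory.GeneralLinear

variable {V : Type u} [AddCommGroup V] [Module ℚ V] [Module.Finite ℚ V] [HodgeTensorFacts.{u, u}] {n : ℤ}
  {S : Type u} [Fintype S] [DecidableEq S] {deg : S → ℤ}

/-! ## §1 The column of `E` for the twisted trace form -/

/-- **`dim V · tr(a_ℂ Y E) = tr(a) · tr(Y E)` for `Y` in a Lie subalgebra `𝔏'` with carrier `𝔥_ℂ`** and a rational Hodge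
endomorphism `a` (type-III position): on the adapted basis the only non-zero entries are at `Y = F`, where
`tr(a F E) = α tr(a_ℂ)/2` and `tr(F E) = α dim V / 2`. [cite: MoonenZarhin1999LowDim, §2 (2.3)]
[cite: Deligne1982HodgeCycles, I §3 (3.4–3.6)] -/
theorem finrank_mul_trace_mul_mul_projE (H : HodgeStructure V n) (ψ : H.Polarization) (hn : n = 1)
    (e : Module.Basis S ℂ (ℂ ⊗[ℚ] V)) (hF : ∀ a, H.F a = Submodule.span ℂ (e '' {σ | a ≤ deg σ}))
    (hFc : ∀ a, complexConj (H.F a) = Submodule.span ℂ (e '' {σ | deg σ ≤ n - a}))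
    (hdeg : ∀ σ, deg σ = 0 ∨ deg σ = 1) {X : Module.End ℚ V} (hX : X ∈ H.hodgeLie) (hXE : X ∉ H.endAlg)
    (hplus : ∀ Y ∈ H.hodgeLieC, ∃ c : ℂ,
      gradingEnd e deg * Y * (1 - gradingEnd e deg) = c • (gradingEnd e deg * X.baseChange ℂ * (1 - gradingEnd e deg)))
    (hminus : ∀ Y ∈ H.hodgeLieC, ∃ c : ℂ,
      (1 - gradingEnd e deg) * Y * gradingEnd e deg = c • ((1 - gradingEnd e deg) * X.baseChange ℂ * gradingEnd e deg))
    (hz : H.hodgeLie ⊓ Subalgebra.toSubmodule H.endAlg = ⊥) (a : H.endAlg) :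
    letI : LieRing (Module.End ℂ (ℂ ⊗[ℚ] V)) := LieRing.ofAssociativeRing
    ∀ (𝔏' : LieSubalgebra ℂ (Module.End ℂ (ℂ ⊗[ℚ] V))) (_h𝔏' : 𝔏'.toSubmodule = H.hodgeLieC) (Y : 𝔏'),
      (Module.finrank ℚ V : ℂ) * LinearMap.trace ℂ (ℂ ⊗[ℚ] V)
          ((a : Module.End ℚ V).baseChange ℂ * Y * (gradingEnd e deg * X.baseChange ℂ * (1 - gradingEnd e deg))) =
        LinearMap.trace ℂ (ℂ ⊗[ℚ] V) ((a : Module.End ℚ V).baseChange ℂ) *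
          LinearMap.trace ℂ (ℂ ⊗[ℚ] V) ((Y : Module.End ℂ (ℂ ⊗[ℚ] V)) *
            (gradingEnd e deg * X.baseChange ℂ * (1 - gradingEnd e deg))) := by
  letI : LieRing (Module.End ℂ (ℂ ⊗[ℚ] V)) := LieRing.ofAssociativeRing
  intro 𝔏' h𝔏' Y
  classical
  obtain ⟨α, hα, hEF, hFE, -⟩ :=
    projE_mul_projF_eq_smul_of_plusLine_of_center_eq_bot H ψ hn e hF hFc hdeg hX hXE hplus hminus hz
  obtain ⟨m, b, hb0, hb1, hb2, hbr⟩ := exists_basis_plusLine H hn e hF hFc hdeg hX hXE hplus hminus 𝔏' h𝔏'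
  have hPP : gradingEnd e deg * gradingEnd e deg = gradingEnd e deg := gradingEnd_mul_gradingEnd_of_deg e hdeg
  have hΘM : (2 : ℂ) • gradingEnd e deg - 1 ∈ H.hodgeLieC := by rw [← hb2, ← h𝔏']; exact (b (Sum.inl 2)).2
  have hEM : gradingEnd e deg * X.baseChange ℂ * (1 - gradingEnd e deg) ∈ H.hodgeLieC := by
    rw [← hb0, ← h𝔏']; exact (b (Sum.inl 0)).2
  -- `a_ℂ` commutes with `𝔥_ℂ`, in particular with `E` and `P`
  set a' := (a : Module.End ℚ V).baseChange ℂ with ha'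
  have haE : a' * (gradingEnd e deg * X.baseChange ℂ * (1 - gradingEnd e deg)) =
      (gradingEnd e deg * X.baseChange ℂ * (1 - gradingEnd e deg)) * a' :=
    (H.commute_baseChange_of_mem_hodgeLieC hEM a).symm
  have haΘ : a' * ((2 : ℂ) • gradingEnd e deg - 1) = ((2 : ℂ) • gradingEnd e deg - 1) * a' :=
    (H.commute_baseChange_of_mem_hodgeLieC hΘM a).symm
  have haP : a' * gradingEnd e deg = gradingEnd e deg * a' := by
    have h2 := haΘ
    rw [mul_sub, sub_mul, mul_one, one_mul, mul_smul_comm, smul_mul_assoc] at h2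
    exact smul_right_injective (Module.End ℂ (ℂ ⊗[ℚ] V)) (two_ne_zero' ℂ) (sub_left_injective h2)
  set P := gradingEnd e deg with hP
  set E := P * X.baseChange ℂ * (1 - P) with hEdef
  set F := (1 - P) * X.baseChange ℂ * P with hFdef
  have hPE : P * E = E := by rw [hEdef, ← mul_assoc, ← mul_assoc, hPP]
  have hEP : E * P = 0 := by
    rw [hEdef, mul_assoc (P * X.baseChange ℂ) (1 - P) P, sub_mul, one_mul, hPP, sub_self, mul_zero]
  have hPF : P * F = 0 := by
    rw [hFdef, mul_assoc (1 - P) (X.baseChange ℂ) P, ← mul_assoc P (1 - P), mul_sub, mul_one, hPP, sub_self, zero_mul]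
  have hFP : F * P = F := by rw [hFdef, mul_assoc ((1 - P) * X.baseChange ℂ) P P, hPP]
  obtain ⟨hEE, -⟩ := SL2Triple.mul_self_eq_zero hPE hEP hPF hFP
  clear_value P E F
  -- traces: `2 tr P = dim V`, `2 tr(a' P) = tr a'`
  have hd : 2 * LinearMap.trace ℂ (ℂ ⊗[ℚ] V) P = (Module.finrank ℚ V : ℂ) := by
    have h := (two_mul_trace_mul_proj (z := 1) hα hEF hFE (by rw [one_mul, mul_one])).1
    rw [one_mul, LinearMap.trace_one, Module.finrank_baseChange] at h
    exact h
  have haP2 : 2 * LinearMap.trace ℂ (ℂ ⊗[ℚ] V) (a' * P) = LinearMap.trace ℂ (ℂ ⊗[ℚ] V) a' :=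
    (two_mul_trace_mul_proj hα hEF hFE haE).1
  -- the column of `E`, basis vector by basis vector
  have htrE : LinearMap.trace ℂ (ℂ ⊗[ℚ] V) ((b (Sum.inl 0) : Module.End ℂ (ℂ ⊗[ℚ] V)) * E) = 0 := by
    rw [hb0, hEE, map_zero]
  have htraE : LinearMap.trace ℂ (ℂ ⊗[ℚ] V) (a' * (b (Sum.inl 0) : Module.End ℂ (ℂ ⊗[ℚ] V)) * E) = 0 := by
    rw [hb0, mul_assoc, hEE, mul_zero, map_zero]
  have htrF : LinearMap.trace ℂ (ℂ ⊗[ℚ] V) ((b (Sum.inl 1) : Module.End ℂ (ℂ ⊗[ℚ] V)) * E) =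
      α * (LinearMap.trace ℂ (ℂ ⊗[ℚ] V) 1 - LinearMap.trace ℂ (ℂ ⊗[ℚ] V) P) := by
    rw [hb1, hFE, map_smul, map_sub, smul_eq_mul]
  have htraF : LinearMap.trace ℂ (ℂ ⊗[ℚ] V) (a' * (b (Sum.inl 1) : Module.End ℂ (ℂ ⊗[ℚ] V)) * E) =
      α * (LinearMap.trace ℂ (ℂ ⊗[ℚ] V) a' - LinearMap.trace ℂ (ℂ ⊗[ℚ] V) (a' * P)) := by
    rw [hb1, mul_assoc, hFE, mul_smul_comm, map_smul, mul_sub, mul_one, map_sub, smul_eq_mul]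
  have h1 : LinearMap.trace ℂ (ℂ ⊗[ℚ] V) (1 : Module.End ℂ (ℂ ⊗[ℚ] V)) = (Module.finrank ℚ V : ℂ) := by
    rw [LinearMap.trace_one, Module.finrank_baseChange]
  have htrΘ : LinearMap.trace ℂ (ℂ ⊗[ℚ] V) ((b (Sum.inl 2) : Module.End ℂ (ℂ ⊗[ℚ] V)) * E) = 0 := by
    have h := trace_mul_theta_mul_eq_zero (z := 1) (Z := E) hα hEF hFE (by rw [one_mul, mul_one]) rfl
    rw [one_mul] at h
    rw [hb2, h]
  have htraΘ : LinearMap.trace ℂ (ℂ ⊗[ℚ] V) (a' * (b (Sum.inl 2) : Module.End ℂ (ℂ ⊗[ℚ] V)) * E) = 0 := by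
    rw [hb2, trace_mul_theta_mul_eq_zero hα hEF hFE haE rfl]
  have htrk : ∀ j, LinearMap.trace ℂ (ℂ ⊗[ℚ] V) ((b (Sum.inr j) : Module.End ℂ (ℂ ⊗[ℚ] V)) * E) = 0 := fun j => by
    have h := trace_mul_projE_mul_eq_zero (z := 1) (Z := (b (Sum.inr j) : Module.End ℂ (ℂ ⊗[ℚ] V))) hPP hPE hEP
      (by rw [one_mul, mul_one]) (hbr j).1
    rw [one_mul, LinearMap.trace_mul_comm] at h
    exact h
  have htrak : ∀ j, LinearMap.trace ℂ (ℂ ⊗[ℚ] V) (a' * (b (Sum.inr j) : Module.End ℂ (ℂ ⊗[ℚ] V)) * E) = 0 :=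
    fun j => by
    rw [mul_assoc, (hbr j).2, ← mul_assoc]
    exact trace_mul_projE_mul_eq_zero hPP hPE hEP haP (hbr j).1
  -- linearity in `Y`
  suffices hbasis : ∀ i, (Module.finrank ℚ V : ℂ) *
      LinearMap.trace ℂ (ℂ ⊗[ℚ] V) (a' * (b i : Module.End ℂ (ℂ ⊗[ℚ] V)) * E) =
      LinearMap.trace ℂ (ℂ ⊗[ℚ] V) a' * LinearMap.trace ℂ (ℂ ⊗[ℚ] V) ((b i : Module.End ℂ (ℂ ⊗[ℚ] V)) * E) by
    have hY : Y = ∑ i, b.repr Y i • b i := (b.sum_repr Y).symm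
    have h1 : LinearMap.trace ℂ (ℂ ⊗[ℚ] V) (a' * (Y : Module.End ℂ (ℂ ⊗[ℚ] V)) * E) =
        ∑ i, b.repr Y i * LinearMap.trace ℂ (ℂ ⊗[ℚ] V) (a' * (b i : Module.End ℂ (ℂ ⊗[ℚ] V)) * E) := by
      conv_lhs => rw [hY]
      simp only [AddSubmonoidClass.coe_finsetSum, SetLike.val_smul, Finset.mul_sum, Finset.sum_mul, mul_smul_comm,
        smul_mul_assoc, map_sum, map_smul, smul_eq_mul]
    have h2 : LinearMap.trace ℂ (ℂ ⊗[ℚ] V) ((Y : Module.End ℂ (ℂ ⊗[ℚ] V)) * E) =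
        ∑ i, b.repr Y i * LinearMap.trace ℂ (ℂ ⊗[ℚ] V) ((b i : Module.End ℂ (ℂ ⊗[ℚ] V)) * E) := by
      conv_lhs => rw [hY]
      simp only [AddSubmonoidClass.coe_finsetSum, SetLike.val_smul, Finset.sum_mul, smul_mul_assoc, map_sum, map_smul,
        smul_eq_mul]
    simp only [h1, h2, Finset.mul_sum]
    exact Finset.sum_congr rfl fun i _ => by linear_combination (b.repr Y i) * hbasis i
  intro i
  rcases i with i | j
  · obtain rfl | rfl | rfl : i = 0 ∨ i = 1 ∨ i = 2 := by fin_cases i <;> simp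
    · simp only [htraE, htrE, mul_zero]
    · simp only [htraF, htrF, h1]
      linear_combination (α * LinearMap.trace ℂ (ℂ ⊗[ℚ] V) (a' * P)) * hd -
        (α * LinearMap.trace ℂ (ℂ ⊗[ℚ] V) P) * haP2
    · simp only [htraΘ, htrΘ, mul_zero]
  · simp only [htrak j, htrk j, mul_zero]

/-! ## §2 `dim V · tr(z x y) = tr z · tr(x y)` -/

/-- **`dim_ℚ V · tr(a_ℂ x y) = tr(a) · tr(x y)` for every RATIONAL Hodge endomorphism `a` and all `x, y ∈ 𝔥_ℂ`** (type-III
position, `𝔷 = 0`, `Lie Hg` `ℚ`-simple): the rational invariant form `β_a = dim V · τ_a − tr a · τ` on the simple `Lie Hg` has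
`E` in the radical of its complexification (`finrank_mul_trace_mul_mul_projE`), hence is degenerate, hence vanishes; then extend
`ℂ`-bilinearly. [cite: MoonenZarhin1999LowDim, §2 (2.3)] [cite: Jacobson1962LieAlgebras, Ch. X §1 and Ch. III §4]
[cite: Deligne1982HodgeCycles, I §3 (3.4–3.6)] -/
theorem finrank_mul_trace_mul_mul_eq_of_mem_endAlg (H : HodgeStructure V n) (ψ : H.Polarization) (hn : n = 1)
    (e : Module.Basis S ℂ (ℂ ⊗[ℚ] V)) (hF : ∀ a, H.F a = Submodule.span ℂ (e '' {σ | a ≤ deg σ}))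
    (hFc : ∀ a, complexConj (H.F a) = Submodule.span ℂ (e '' {σ | deg σ ≤ n - a}))
    (hdeg : ∀ σ, deg σ = 0 ∨ deg σ = 1) {X : Module.End ℚ V} (hX : X ∈ H.hodgeLie) (hXE : X ∉ H.endAlg)
    (hplus : ∀ Y ∈ H.hodgeLieC, ∃ c : ℂ,
      gradingEnd e deg * Y * (1 - gradingEnd e deg) = c • (gradingEnd e deg * X.baseChange ℂ * (1 - gradingEnd e deg)))
    (hminus : ∀ Y ∈ H.hodgeLieC, ∃ c : ℂ,
      (1 - gradingEnd e deg) * Y * gradingEnd e deg = c • ((1 - gradingEnd e deg) * X.baseChange ℂ * gradingEnd e deg))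
    (hz : H.hodgeLie ⊓ Subalgebra.toSubmodule H.endAlg = ⊥)
    (hsimple : letI : LieRing (Module.End ℚ V) := LieRing.ofAssociativeRing
      ∀ 𝔏 : LieSubalgebra ℚ (Module.End ℚ V), 𝔏.toSubmodule = H.hodgeLie → LieAlgebra.IsSimple ℚ 𝔏)
    (a : H.endAlg) {x y : Module.End ℂ (ℂ ⊗[ℚ] V)} (hx : x ∈ H.hodgeLieC) (hy : y ∈ H.hodgeLieC) :
    (Module.finrank ℚ V : ℂ) * LinearMap.trace ℂ (ℂ ⊗[ℚ] V) ((a : Module.End ℚ V).baseChange ℂ * x * y) =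
      algebraMap ℚ ℂ (LinearMap.trace ℚ V (a : Module.End ℚ V)) * LinearMap.trace ℂ (ℂ ⊗[ℚ] V) (x * y) := by
  classical
  letI : LieRing (Module.End ℚ V) := LieRing.ofAssociativeRing
  letI : LieRing (Module.End ℂ (ℂ ⊗[ℚ] V)) := LieRing.ofAssociativeRing
  -- the Lie algebras `𝔏` (carrier `Lie Hg`) and `𝔏'` (carrier `𝔥_ℂ`)
  obtain ⟨𝔏, h𝔏⟩ : ∃ 𝔏 : LieSubalgebra ℚ (Module.End ℚ V), 𝔏.toSubmodule = H.hodgeLie :=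
    ⟨{ H.hodgeLie with
        lie_mem' := fun {a b} ha hb => by
          rw [LieRing.of_associative_ring_bracket]
          exact H.commutator_mem_hodgeLie ha hb }, rfl⟩
  obtain ⟨𝔏', h𝔏'⟩ : ∃ 𝔏' : LieSubalgebra ℂ (Module.End ℂ (ℂ ⊗[ℚ] V)), 𝔏'.toSubmodule = H.hodgeLieC :=
    ⟨{ H.hodgeLieC with
        lie_mem' := fun {a b} ha hb => by
          rw [LieRing.of_associative_ring_bracket]
          exact H.commutator_mem_hodgeLieC ha hb }, rfl⟩
  haveI := hsimple 𝔏 h𝔏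
  have h𝔏'' : 𝔏'.toSubmodule = spanC 𝔏.toSubmodule := by rw [h𝔏', h𝔏, hodgeLieC_eq_spanC]
  have hcommℚ : ∀ Z : 𝔏, (a : Module.End ℚ V) * (Z : Module.End ℚ V) = (Z : Module.End ℚ V) * a := fun Z =>
    (H.commute_of_mem_hodgeLie (by rw [← h𝔏]; exact Z.2) a).symm
  -- the rational form `β = d τ_a − tr(a) τ`
  set d : ℚ := (Module.finrank ℚ V : ℚ) with hd
  set t : ℚ := LinearMap.trace ℚ V (a : Module.End ℚ V) with ht
  obtain ⟨τa, hτa⟩ : ∃ τa : LinearMap.BilinForm ℚ 𝔏, ∀ X₁ Y₁ : 𝔏,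
      τa X₁ Y₁ = LinearMap.trace ℚ V ((a : Module.End ℚ V) * X₁ * Y₁) := by
    refine ⟨LinearMap.mk₂ ℚ (fun X₁ Y₁ : 𝔏 => LinearMap.trace ℚ V ((a : Module.End ℚ V) * X₁ * Y₁)) ?_ ?_ ?_ ?_,
      fun _ _ => rfl⟩
    · intro x₁ x₂ y₁
      simp only [AddMemClass.coe_add, mul_add, add_mul, map_add]
    · intro c x₁ y₁
      simp only [SetLike.val_smul, mul_smul_comm, smul_mul_assoc, map_smul]
    · intro x₁ y₁ y₂
      simp only [AddMemClass.coe_add, mul_add, map_add]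
    · intro c x₁ y₁
      simp only [SetLike.val_smul, mul_smul_comm, map_smul]
  obtain ⟨β, hβ⟩ : ∃ β : LinearMap.BilinForm ℚ 𝔏, β = d • τa - t • LieModule.traceForm ℚ 𝔏 V := ⟨_, rfl⟩
  have hβapply : ∀ X₁ Y₁ : 𝔏, β X₁ Y₁ =
      d * LinearMap.trace ℚ V ((a : Module.End ℚ V) * X₁ * Y₁) - t * LinearMap.trace ℚ V ((X₁ : Module.End ℚ V) * Y₁) := by
    intro X₁ Y₁
    rw [hβ, LinearMap.sub_apply, LinearMap.smul_apply, LinearMap.smul_apply, LinearMap.sub_apply, LinearMap.smul_apply,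
      LinearMap.smul_apply, hτa, LieModule.traceForm_apply_apply, smul_eq_mul, smul_eq_mul]
    rfl
  have hβinv : β.lieInvariant 𝔏 := by
    intro x₁ y₁ z₁
    rw [hβapply, hβapply]
    have h2 := LieModule.traceForm_lieInvariant ℚ 𝔏 V x₁ y₁ z₁
    rw [LieModule.traceForm_apply_apply, LieModule.traceForm_apply_apply] at h2
    change LinearMap.trace ℚ V ((⁅x₁, y₁⁆ : 𝔏) * (z₁ : Module.End ℚ V)) =
      -LinearMap.trace ℚ V ((y₁ : Module.End ℚ V) * (⁅x₁, z₁⁆ : 𝔏)) at h2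
    have h1 : LinearMap.trace ℚ V ((a : Module.End ℚ V) * (⁅x₁, y₁⁆ : 𝔏) * z₁) =
        -LinearMap.trace ℚ V ((a : Module.End ℚ V) * y₁ * (⁅x₁, z₁⁆ : 𝔏)) := by
      rw [LieSubalgebra.coe_bracket, LieSubalgebra.coe_bracket, LieRing.of_associative_ring_bracket,
        LieRing.of_associative_ring_bracket, mul_sub, sub_mul, mul_sub, map_sub, map_sub]
      have hc : LinearMap.trace ℚ V ((a : Module.End ℚ V) * x₁ * y₁ * z₁) =
          LinearMap.trace ℚ V ((a : Module.End ℚ V) * y₁ * z₁ * x₁) := by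
        rw [hcommℚ x₁, mul_assoc (x₁ : Module.End ℚ V) (a : Module.End ℚ V), mul_assoc (x₁ : Module.End ℚ V),
          LinearMap.trace_mul_comm]
      simp only [mul_assoc] at hc ⊢
      rw [hc]
      ring
    rw [h1, h2]
    ring
  -- the complex form
  obtain ⟨hEM, -⟩ := projE_mem_hodgeLieC H e hF hFc hdeg (H.baseChange_mem_hodgeLieC hX)
  have hEM' : gradingEnd e deg * X.baseChange ℂ * (1 - gradingEnd e deg) ∈ 𝔏' := by
    rw [← LieSubalgebra.mem_toSubmodule, h𝔏']; exact hEM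
  obtain ⟨E', hE'⟩ : ∃ E' : 𝔏', (E' : Module.End ℂ (ℂ ⊗[ℚ] V)) =
      gradingEnd e deg * X.baseChange ℂ * (1 - gradingEnd e deg) := ⟨⟨_, hEM'⟩, rfl⟩
  have hE'0 : E' ≠ 0 := by
    intro h0
    apply (projE_ne_zero_of_not_mem_endAlg H hn e hF hFc hdeg hXE).1
    rw [← hE', h0]
    exact ZeroMemClass.coe_zero _
  set a' := (a : Module.End ℚ V).baseChange ℂ with ha'
  obtain ⟨β', hβ'⟩ : ∃ β' : 𝔏'.toSubmodule → 𝔏'.toSubmodule → ℂ, ∀ x₁ y₁, β' x₁ y₁ =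
      (d : ℂ) * LinearMap.trace ℂ (ℂ ⊗[ℚ] V) (a' * (x₁ : Module.End ℂ (ℂ ⊗[ℚ] V)) * y₁) -
        algebraMap ℚ ℂ t * LinearMap.trace ℂ (ℂ ⊗[ℚ] V) ((x₁ : Module.End ℂ (ℂ ⊗[ℚ] V)) * y₁) := ⟨_, fun _ _ => rfl⟩
  have hβ'add : ∀ y₁ x₁ x₂ : 𝔏'.toSubmodule, β' y₁ (x₁ + x₂) = β' y₁ x₁ + β' y₁ x₂ := by
    intro y₁ x₁ x₂; rw [hβ', hβ', hβ', Submodule.coe_add, mul_add, mul_add, map_add, map_add]; ring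
  have hβ'smul : ∀ (c : ℂ) (y₁ x₁ : 𝔏'.toSubmodule), β' y₁ (c • x₁) = c * β' y₁ x₁ := by
    intro c y₁ x₁
    rw [hβ', hβ', Submodule.coe_smul, mul_smul_comm, mul_smul_comm, map_smul, map_smul, smul_eq_mul, smul_eq_mul]; ring
  have hβ'add' : ∀ x₁ x₂ y₁ : 𝔏'.toSubmodule, β' (x₁ + x₂) y₁ = β' x₁ y₁ + β' x₂ y₁ := by
    intro x₁ x₂ y₁; rw [hβ', hβ', hβ', Submodule.coe_add, mul_add, add_mul, add_mul, map_add, map_add]; ring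
  have hβ'smul' : ∀ (c : ℂ) (x₁ y₁ : 𝔏'.toSubmodule), β' (c • x₁) y₁ = c * β' x₁ y₁ := by
    intro c x₁ y₁
    rw [hβ', hβ', Submodule.coe_smul, mul_smul_comm, smul_mul_assoc, smul_mul_assoc, map_smul, map_smul, smul_eq_mul,
      smul_eq_mul]; ring
  have htra' : LinearMap.trace ℂ (ℂ ⊗[ℚ] V) a' = algebraMap ℚ ℂ t := by rw [ha', LinearMap.trace_baseChange]
  have hcol := finrank_mul_trace_mul_mul_projE H ψ hn e hF hFc hdeg hX hXE hplus hminus hz a 𝔏' h𝔏'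
  have hEeta : (⟨E'.1, E'.2⟩ : 𝔏') = E' := rfl
  have hrad : ∀ y' : 𝔏'.toSubmodule, β' y' ⟨E'.1, E'.2⟩ = 0 := by
    intro y'
    have h := hcol ⟨y'.1, y'.2⟩
    rw [← hE', htra'] at h
    simp only [hβ', hd, Rat.cast_natCast]
    linear_combination h
  have hcompat : ∀ (X₁ Y₁ : 𝔏.toSubmodule) (hX₁ : (X₁ : Module.End ℚ V).baseChange ℂ ∈ 𝔏'.toSubmodule)
      (hY₁ : (Y₁ : Module.End ℚ V).baseChange ℂ ∈ 𝔏'.toSubmodule), β' ⟨_, hX₁⟩ ⟨_, hY₁⟩ = algebraMap ℚ ℂ (β X₁ Y₁) := by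
    intro X₁ Y₁ hX₁ hY₁
    rw [hβ', hβapply]
    change (d : ℂ) * LinearMap.trace ℂ (ℂ ⊗[ℚ] V) (a' * (X₁ : Module.End ℚ V).baseChange ℂ * (Y₁ : Module.End ℚ V).baseChange ℂ) -
      algebraMap ℚ ℂ t * LinearMap.trace ℂ (ℂ ⊗[ℚ] V)
        ((X₁ : Module.End ℚ V).baseChange ℂ * (Y₁ : Module.End ℚ V).baseChange ℂ) = _
    rw [ha', trace_baseChange_mul_mul, ← LinearMap.baseChange_mul, LinearMap.trace_baseChange]
    simp only [map_sub, map_mul, hd, map_natCast, Rat.cast_natCast]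
  -- descent, simplicity, ascent
  obtain ⟨x₀, hx0, hxrad⟩ := exists_ne_zero_orthogonal_of_spanC 𝔏.toSubmodule 𝔏'.toSubmodule h𝔏'' β β' hβ'add hβ'smul
    hcompat (x' := ⟨E'.1, E'.2⟩) (fun h0 => hE'0 (Subtype.ext (congrArg Subtype.val h0))) hrad
  have hβ0 : β = 0 := Literature.Algebra.Lie.InvariantFormSimple.eq_zero_of_isSimple_of_orthogonal hβinv hx0 hxrad
  have hβ00 : ∀ X₁ Y₁ : 𝔏, β X₁ Y₁ = 0 := fun X₁ Y₁ => by rw [hβ0]; rfl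
  have hx' : x ∈ 𝔏' := by rw [← LieSubalgebra.mem_toSubmodule, h𝔏']; exact hx
  have hy' : y ∈ 𝔏' := by rw [← LieSubalgebra.mem_toSubmodule, h𝔏']; exact hy
  have h := forall_eq_zero_of_spanC 𝔏.toSubmodule 𝔏'.toSubmodule h𝔏'' β β' hβ'add hβ'smul hβ'add' hβ'smul' hcompat hβ00
    ⟨x, hx'⟩ ⟨y, hy'⟩
  rw [hβ'] at h
  change (d : ℂ) * LinearMap.trace ℂ (ℂ ⊗[ℚ] V) (a' * x * y) - algebraMap ℚ ℂ t * LinearMap.trace ℂ (ℂ ⊗[ℚ] V) (x * y) = 0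
    at h
  rw [hd, Rat.cast_natCast] at h
  linear_combination h

/-- **`dim_ℚ V · tr(z x y) = tr z · tr(x y)` for every `z ∈ End_Hdg(V) ⊗ ℂ = span_ℂ {a_ℂ : a ∈ End_Hdg}` and all
`x, y ∈ 𝔥_ℂ`** (type-III position, `𝔷 = 0`, `Lie Hg` `ℚ`-simple): `ℂ`-linear in `z` from
`finrank_mul_trace_mul_mul_eq_of_mem_endAlg`.  By `mem_span_endAlg_of_forall_commute` this covers every operator commuting with
`𝔥_ℂ`. [cite: MoonenZarhin1999LowDim, §2 (2.3)] [cite: Deligne1982HodgeCycles, I §3 (3.4–3.6)] -/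
theorem finrank_mul_trace_mul_mul_eq_of_mem_spanC_endAlg (H : HodgeStructure V n) (ψ : H.Polarization) (hn : n = 1)
    (e : Module.Basis S ℂ (ℂ ⊗[ℚ] V)) (hF : ∀ a, H.F a = Submodule.span ℂ (e '' {σ | a ≤ deg σ}))
    (hFc : ∀ a, complexConj (H.F a) = Submodule.span ℂ (e '' {σ | deg σ ≤ n - a}))
    (hdeg : ∀ σ, deg σ = 0 ∨ deg σ = 1) {X : Module.End ℚ V} (hX : X ∈ H.hodgeLie) (hXE : X ∉ H.endAlg)
    (hplus : ∀ Y ∈ H.hodgeLieC, ∃ c : ℂ,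
      gradingEnd e deg * Y * (1 - gradingEnd e deg) = c • (gradingEnd e deg * X.baseChange ℂ * (1 - gradingEnd e deg)))
    (hminus : ∀ Y ∈ H.hodgeLieC, ∃ c : ℂ,
      (1 - gradingEnd e deg) * Y * gradingEnd e deg = c • ((1 - gradingEnd e deg) * X.baseChange ℂ * gradingEnd e deg))
    (hz : H.hodgeLie ⊓ Subalgebra.toSubmodule H.endAlg = ⊥)
    (hsimple : letI : LieRing (Module.End ℚ V) := LieRing.ofAssociativeRing
      ∀ 𝔏 : LieSubalgebra ℚ (Module.End ℚ V), 𝔏.toSubmodule = H.hodgeLie → LieAlgebra.IsSimple ℚ 𝔏)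
    {z : Module.End ℂ (ℂ ⊗[ℚ] V)}
    (hzm : z ∈ Submodule.span ℂ ((fun c : Module.End ℚ V => c.baseChange ℂ) '' (H.endAlg : Set (Module.End ℚ V))))
    {x y : Module.End ℂ (ℂ ⊗[ℚ] V)} (hx : x ∈ H.hodgeLieC) (hy : y ∈ H.hodgeLieC) :
    (Module.finrank ℚ V : ℂ) * LinearMap.trace ℂ (ℂ ⊗[ℚ] V) (z * x * y) =
      LinearMap.trace ℂ (ℂ ⊗[ℚ] V) z * LinearMap.trace ℂ (ℂ ⊗[ℚ] V) (x * y) := by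
  induction hzm using Submodule.span_induction with
  | mem z hzc =>
    obtain ⟨c, hc, rfl⟩ := hzc
    have h := finrank_mul_trace_mul_mul_eq_of_mem_endAlg H ψ hn e hF hFc hdeg hX hXE hplus hminus hz hsimple ⟨c, hc⟩ hx hy
    simpa only [LinearMap.trace_baseChange] using h
  | zero => simp only [zero_mul, map_zero, mul_zero]
  | add z₁ z₂ _ _ h₁ h₂ => rw [add_mul, add_mul, map_add, map_add, mul_add, add_mul, h₁, h₂]
  | smul c z₁ _ h₁ =>
    rw [smul_mul_assoc, smul_mul_assoc, map_smul, map_smul, smul_eq_mul, smul_eq_mul, mul_left_comm, h₁, mul_assoc]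

end HodgeStructure

end Literature.AlgebraicGeometry.Motives

end
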